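import Mathlib
import Literature.Analysis.FluidPDE.WholeSpaceIBP
import Literature.Analysis.FluidPDE.ClassicalSolutionCalculus
import Literature.Analysis.FluidPDE.VectorCalculusProofs
import Literature.Analysis.FluidPDE.VorticityStretching
import Literature.Analysis.FluidPDE.LocalBiotSavartCalculus
import HarnessLib

/-!
# Crux `NoFrozenEddyCollapse` (stmt-NavierStokesRegularity-1431), line `SketchIdeator1`:
  STUB `stub_noShellBalance` — partial result: the GLOBAL HELICITY SHELL LAW (`g ≡ 1`)

Helper file (lands `--supports stmt-NavierStokesRegularity-1431`) for the registered stub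
`stub_noShellBalance` of the skeleton `NoFrozenEddyCollapse` (card `shell-balance-edge-torsion`).

The stub asks: no nonzero smooth compactly supported steady Euler flow `(U, P)` has its frozen
drift `𝓛̃U = ΔU − αℓ²U − (ℓ²/2) DU·y` `L²`-orthogonal to all Bernoulli-shell fields `f(B) U` and
`g(B) curl U`.  This file records the `g ≡ 1` member of the helicity family in closed form
(`ω = curl U`; everything is kinematic — the Euler equation is not used):

* `integral_inner_fderiv_apply_id_curl` — the dilation identity for the helicity,
  `∫ ⟪DU(y) y, ω⟫ = −∫ ⟪U, ω⟫` for `U ∈ C²_c`: pointwise `⟪DU y, ω⟫ = ⟪y, DU ω⟫` (the vorticity is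
  in the kernel of the spin matrix `DU − DUᵀ`), then the trilinear identity
  `integral_inner_convect_add_eq_zero` with `u = ω` (`div ω = 0`), `v = id`, `w = U`
  (equivalently `d/dλ|₁` of `H(U(λ·)) = λ⁻² H(U)`);
* `integral_inner_laplacian_curl` — `∫ ⟪ΔU, ω⟫ = −∫ ⟪ω, curl ω⟫` for divergence-free `U ∈ C²`
  (`Δ = −curl curl` on solenoidal fields, the tree's `laplacian_eq_neg_curl_curl`, pointwise);
* `integral_inner_frozenDrift_curl` — hence, for divergence-free `U ∈ C²_c`,
  `∫ ⟪ΔU − αℓ²U − (ℓ²/2) DU·y, ω⟫ = −∫ ⟪ω, curl ω⟫ − ℓ²(α − 1/2) ∫ ⟪U, ω⟫`;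
* `shellHelicity_one` (registered helper stub) — under the helicity-shell hypothesis of
  `stub_noShellBalance` (tested at `g ≡ 1`): the superhelicity is slaved to the helicity,
  `∫ ⟪ω, curl ω⟫ = −ℓ²(α − 1/2) ∫ ⟪U, ω⟫` (anti-superhelical for `α > 1/2`; by itself satisfiable,
  e.g. by every flow with `H = S = 0`, so no contradiction at this level — see the stub notes).
Mathlib + `Literature.Analysis.FluidPDE.{WholeSpaceIBP, ClassicalSolutionCalculus,
VectorCalculusProofs, VorticityStretching, LocalBiotSavartCalculus}`.
-/

noncomputable section

open MeasureTheory Set Filter Topology Metric Function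
open scoped RealInnerProductSpace

namespace Summit.NavierStokesRegularity.NavierStokesRegularity.Theorems.NoFrozenEddyCollapse.ShellBalanceEdgeTorsion

open Literature.Analysis.FluidPDE

/-- For a linear map `L` of `ℝ³` and its curl vector `c = curlCLM L` (the axial vector of the
antisymmetric part `L − Lᵀ`), `⟪b, L c⟫ = ⟪L b, c⟫` for every `b`: the difference is
`⟪b, (L − Lᵀ) c⟫ = ⟪b, c × c⟫ = 0`; checked in coordinates (copy of the private lemma of the
sibling file `…StubCokernelHelicity`). -/
private theorem inner_apply_curlCLM_comm_aux
    (L : EuclideanSpace ℝ (Fin 3) →L[ℝ] EuclideanSpace ℝ (Fin 3)) (b : EuclideanSpace ℝ (Fin 3)) :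
    ⟪b, L (curlCLM L)⟫ = ⟪L b, curlCLM L⟫ := by
  simp only [PiLp.inner_apply, RCLike.inner_apply, conj_trivial, clm_apply_coord L b,
    clm_apply_coord L (curlCLM L)]
  simp only [curlCLM_apply, WithLp.ofLp_toLp, Fin.sum_univ_three, Matrix.cons_val_zero,
    Matrix.cons_val_one, Matrix.cons_val_two, Matrix.head_cons, Matrix.tail_cons]
  ring

/-- Field form: `⟪DU(y) b, ω(y)⟫ = ⟪b, DU(y) ω(y)⟫` for `ω = curl U` and every `b ∈ ℝ³`
(`curl U y = curlCLM (DU(y))` definitionally). -/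
private theorem inner_fderiv_apply_curl_aux
    (U : EuclideanSpace ℝ (Fin 3) → EuclideanSpace ℝ (Fin 3)) (y b : EuclideanSpace ℝ (Fin 3)) :
    ⟪fderiv ℝ U y b, curl U y⟫ = ⟪b, fderiv ℝ U y (curl U y)⟫ := by
  rw [curl_eq_curlCLM]
  exact (inner_apply_curlCLM_comm_aux _ _).symm

/-- **Dilation identity for the helicity**: for `U ∈ C²_c(ℝ³; ℝ³)`,
`∫ ⟪DU(y) y, curl U y⟫ = −∫ ⟪U, curl U⟫`.  Proof: `⟪DU(y) y, ω⟫ = ⟪y, DU(y) ω⟫ = ⟪y, (ω·∇)U⟫`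
pointwise, and the trilinear identity with the divergence-free field `ω` against `v = id`, `w = U`
reads `∫ ⟪ω, U⟫ + ∫ ⟪y, (ω·∇)U⟫ = 0`. -/
theorem integral_inner_fderiv_apply_id_curl
    {U : EuclideanSpace ℝ (Fin 3) → EuclideanSpace ℝ (Fin 3)} (hU : ContDiff ℝ 2 U)
    (hc : HasCompactSupport U) :
    ∫ y, ⟪fderiv ℝ U y y, curl U y⟫ = -∫ y, ⟪U y, curl U y⟫ := by
  have hU1 : ContDiff ℝ 1 U := hU.of_le one_le_two
  have hω1 : ContDiff ℝ 1 (curl U) := contDiff_curl (n := 1) (by exact_mod_cast hU)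
  have h := integral_inner_convect_add_eq_zero (u := curl U)
    (v := fun z : EuclideanSpace ℝ (Fin 3) => z) (w := U) hω1 contDiff_id hU1 hc
  have hdiv : ∀ x, VectorCalculus.divergence (curl U) x = 0 := fun x =>
    divergence_curl_eq_zero_holds U hU x
  simp only [convect, fderiv_fun_id, ContinuousLinearMap.coe_id', id_eq, hdiv, zero_mul,
    integral_zero, add_zero] at h
  have hpt : ∫ y, ⟪fderiv ℝ U y y, curl U y⟫ = ∫ y, ⟪y, fderiv ℝ U y (curl U y)⟫ :=
    integral_congr_ae (Eventually.of_forall fun y => inner_fderiv_apply_curl_aux U y y)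
  have hcomm : ∫ y, ⟪curl U y, U y⟫ = ∫ y, ⟪U y, curl U y⟫ :=
    integral_congr_ae (Eventually.of_forall fun y => real_inner_comm _ _)
  rw [hpt]
  linarith

/-- **`∫ ⟪ΔU, curl U⟫ = −∫ ⟪curl U, curl curl U⟫`** for a divergence-free `C²` field on `ℝ³`
(pointwise `ΔU = −curl curl U`, `laplacian_eq_neg_curl_curl`; no integration by parts). -/
theorem integral_inner_laplacian_curl
    {U : EuclideanSpace ℝ (Fin 3) → EuclideanSpace ℝ (Fin 3)} (hU : ContDiff ℝ 2 U)
    (hdiv : VectorCalculus.IsDivFree U) :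
    ∫ y, ⟪Laplacian.laplacian U y, curl U y⟫ = -∫ y, ⟪curl U y, curl (curl U) y⟫ := by
  rw [← integral_neg]
  refine integral_congr_ae (Eventually.of_forall fun y => ?_)
  simp only [laplacian_eq_neg_curl_curl hU hdiv y, inner_neg_left, real_inner_comm]

/-- **The frozen drift against the vorticity** (divergence-free `U ∈ C²_c`):
`∫ ⟪ΔU − αℓ²U − (ℓ²/2) DU·y, curl U⟫ = −∫ ⟪curl U, curl curl U⟫ − ℓ²(α − 1/2) ∫ ⟪U, curl U⟫`. -/
theorem integral_inner_frozenDrift_curl (α ℓ : ℝ)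
    {U : EuclideanSpace ℝ (Fin 3) → EuclideanSpace ℝ (Fin 3)} (hU : ContDiff ℝ 2 U)
    (hc : HasCompactSupport U) (hdiv : VectorCalculus.IsDivFree U) :
    ∫ y, ⟪Laplacian.laplacian U y - (α * ℓ ^ 2) • U y - (ℓ ^ 2 / 2) • fderiv ℝ U y y, curl U y⟫ =
      -(∫ y, ⟪curl U y, curl (curl U) y⟫) - ℓ ^ 2 * (α - 1 / 2) * ∫ y, ⟪U y, curl U y⟫ := by
  have hU1 : ContDiff ℝ 1 U := hU.of_le one_le_two
  have hωc : Continuous (curl U) := continuous_curl hU1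
  have hωs : HasCompactSupport (curl U) := hasCompactSupport_curl hc
  have iL : Integrable (fun y => ⟪Laplacian.laplacian U y, curl U y⟫)
      (volume : Measure (EuclideanSpace ℝ (Fin 3))) :=
    integrable_inner_of_hasCompactSupport_right (continuous_laplacian hU) hωc hωs
  have iP : Integrable (fun y => ⟪U y, curl U y⟫) (volume : Measure (EuclideanSpace ℝ (Fin 3))) :=
    integrable_inner_of_hasCompactSupport_right hU.continuous hωc hωs
  have iD : Integrable (fun y => ⟪fderiv ℝ U y y, curl U y⟫)
      (volume : Measure (EuclideanSpace ℝ (Fin 3))) :=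
    integrable_inner_of_hasCompactSupport_right
      ((hU.continuous_fderiv two_ne_zero).clm_apply continuous_id) hωc hωs
  have key : ∀ y, ⟪Laplacian.laplacian U y - (α * ℓ ^ 2) • U y - (ℓ ^ 2 / 2) • fderiv ℝ U y y,
      curl U y⟫ = ⟪Laplacian.laplacian U y, curl U y⟫ - (α * ℓ ^ 2) * ⟪U y, curl U y⟫ -
        (ℓ ^ 2 / 2) * ⟪fderiv ℝ U y y, curl U y⟫ := fun y => by
    simp only [inner_sub_left, real_inner_smul_left]
  simp_rw [key]
  have hsplit : ∫ y, (⟪Laplacian.laplacian U y, curl U y⟫ - (α * ℓ ^ 2) * ⟪U y, curl U y⟫ -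
      (ℓ ^ 2 / 2) * ⟪fderiv ℝ U y y, curl U y⟫) =
      ((∫ y, ⟪Laplacian.laplacian U y, curl U y⟫) - (α * ℓ ^ 2) * ∫ y, ⟪U y, curl U y⟫) -
        (ℓ ^ 2 / 2) * ∫ y, ⟪fderiv ℝ U y y, curl U y⟫ := by
    rw [integral_sub, integral_sub, integral_const_mul, integral_const_mul]
    all_goals first
      | exact iL
      | exact iP.const_mul _
      | exact iD.const_mul _
      | exact iL.sub (iP.const_mul _)
  rw [hsplit, integral_inner_laplacian_curl hU hdiv, integral_inner_fderiv_apply_id_curl hU hc]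
  ring

/-- **GLOBAL HELICITY SHELL LAW** (`g ≡ 1` in the helicity-shell hypothesis of
`stub_noShellBalance`; registered helper stub of crux `NoFrozenEddyCollapse`, line
`SketchIdeator1`).  If the frozen drift of a smooth, compactly supported, divergence-free `U` is
`L²`-orthogonal to every `g(P + ‖U‖²/2) curl U`, `g` smooth, then the superhelicity is slaved to
the helicity: `∫ ⟪curl U, curl curl U⟫ = −ℓ²(α − 1/2) ∫ ⟪U, curl U⟫`.  Test with `g ≡ 1` and use
`integral_inner_frozenDrift_curl`.  Uses only `ContDiff ⊤ U`, `HasCompactSupport U`, `div U = 0`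
and the `g ≡ 1` balance (`P` and the Euler equation are NOT used). -/
theorem shellHelicity_one :
    ∀ (α ℓ : ℝ) (U : EuclideanSpace ℝ (Fin 3) → EuclideanSpace ℝ (Fin 3))
      (P : EuclideanSpace ℝ (Fin 3) → ℝ),
      ContDiff ℝ (⊤ : ℕ∞) U → HasCompactSupport U → VectorCalculus.IsDivFree U →
      (∀ g : ℝ → ℝ, ContDiff ℝ (⊤ : ℕ∞) g →
        ∫ y, inner ℝ (Laplacian.laplacian U y - (α * ℓ ^ 2) • U y - (ℓ ^ 2 / 2) • (fderiv ℝ U y) y)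
            (g (P y + ‖U y‖ ^ 2 / 2) • curl U y) = 0) →
      ∫ y, inner ℝ (curl U y) (curl (curl U) y) =
        -(ℓ ^ 2 * (α - 1 / 2)) * ∫ y, inner ℝ (U y) (curl U y) := by
  intro α ℓ U P hU hc hdiv hH
  have hU2 : ContDiff ℝ 2 U := hU.of_le (WithTop.coe_le_coe.2 le_top)
  have h := hH (fun _ => 1) contDiff_const
  simp only [one_smul] at h
  rw [integral_inner_frozenDrift_curl α ℓ hU2 hc hdiv] at h
  linarith

end Summit.NavierStokesRegularity.NavierStokesRegularity.Theorems.NoFrozenEddyCollapse.ShellBalanceEdgeTorsion
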